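import Literature.Computability.AlgebraicComplexity.BI17QuadraticPolystableProofs
import Mathlib.Algebra.MvPolynomial.Funext
import Mathlib.Algebra.Polynomial.Degree.SmallDegree
import Mathlib.Algebra.Polynomial.Splits
import Mathlib.FieldTheory.IsAlgClosed.Basic
import HarnessLib

/-!
# Nondegenerate binary cubics are polystable — the `(D, m) = (3, 2)` case of Bürgisser–Ikenmeyer
# 2017, Prop. 2.10 (discharge of a slice of a named fact)

Sibling proof file of `Literature/Computability/AlgebraicComplexity/BI17FundamentalInvariantForms.lean`
(cell `val-lit`, DAG row BI2017-A), continuing `BI17QuadraticPolystableProofs.lean` (the slice `D = 2`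
and the slices `m ≤ 1`): here the slice `(D, m) = (3, 2)` of the named fact
`Literature.Computability.AlgebraicComplexity.BI2017_prop_2_10` (P. Bürgisser, C. Ikenmeyer,
*Fundamental invariants of orbit closures*, J. Algebra 477 (2017) = arXiv:1511.02927, **Prop. 2.10**,
TeX L633–640: "If `D > 1`, then almost all `w ∈ Sym^D ℂ^m` are polystable").

* `isPolystable_binaryCubic` — a binary cubic `a x³ + b x²y + c xy² + d y³` with `a ≠ 0` and
  non-zero discriminant `b²c² − 4ac³ − 4b³d − 27a²d² + 18abcd ≠ 0` is polystable (its `SL₂`-orbit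
  is Zariski closed in coefficient space);
* `BI2017_prop_2_10_three_two : IsZariskiGeneric 3 (IsPolystable : MvPolynomial (Fin 2) ℂ → Prop)` —
  "almost all binary cubics are polystable", test polynomial `A · Disc(A, B, C, D)` on `Sym³ ℂ²`
  (value `−27` at `x³ + y³`).

HONEST PARTIAL: the general `D ≥ 3`, `m ≥ 2` body of Prop. 2.10 (Thm. 2.3 + Luna's étale slice
theorem) is NOT proved; after this file and `BI2017_prop_2_10_of_main` the open part of the fact is
`D ≥ 3, m ≥ 2, (D, m) ≠ (3, 2)`.

## Proof

Not the printed route. A binary cubic with `a · disc ≠ 0` splits over `ℂ` as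
`f = a ∏_{i<3} (x − r_i y)` with pairwise distinct `r_i` (Mathlib's `IsAlgClosed.splits` for the
dehomogenised cubic, Vieta by comparing coefficients, and `disc = a⁴ ∏_{i<j} (r_i − r_j)²`); the
explicit matrix `M = diag(r₁ − r₃, r₂ − r₃) · [[r₂, 1], [r₁, 1]] ∈ GL₂` (it sends the linear forms
`x − r₁ y`, `x − r₂ y`, `x − r₃ y` to multiples of `x`, `y`, `x + y`) gives
`M · f = c · x y (x + y)` with `c = −a ∏_{i<j} (r_i − r_j)² ≠ 0` (`exists_linSubst_eq_smul_xyxy`);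
the same recipe applied to `x³ + y³ = (x + y)(x + ω y)(x + ω² y)` (roots `−1, −ω, −ω²`) puts
`x³ + y³` in the same `GL₂ · ℂ^× · xy(x+y)`, so `f ∈ GL₂ · (x³ + y³)` (a cube root absorbs the
scalar, `linSubst_smul_of_isHomogeneous`); and `x³ + y³` is polystable (`isPolystable_sum_X_pow`,
Kempf–Ness route, BI 2017 Cor. 2.9) while polystability is a property of `GL`-orbits
(`IsPolystable.linSubst_of_det_ne_zero`, `BI17QuadraticPolystableProofs.lean`).

Everything is PROVED; no named facts, no `instance`, no `notation`; one private plumbing `def`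
(`cubicDisc`, the discriminant of a binary cubic as a function of its four coefficients).

Honest framing: bookkeeping of a classical invariant-theory fact inside the BIP literature
programme; nothing here bears on lower bounds or on `VP` versus `VNP`.

## References

* [BurgisserIkenmeyer2017] P. Bürgisser, C. Ikenmeyer, J. Algebra 477 (2017) = arXiv:1511.02927,
  Prop. 2.10 (TeX L633–640), Def. 2.7, Cor. 2.9.
-/

noncomputable section

open MvPolynomial Matrix

namespace Literature.Computability.AlgebraicComplexity

namespace BinaryCubic

/-! ### Monomials of degree `3` in two variables -/

/-- An exponent vector on `Fin 2` is `(e 0, e 1)`. [folklore] -/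
private theorem finsupp_fin_two_eq (e : Fin 2 →₀ ℕ) :
    e = Finsupp.single 0 (e 0) + Finsupp.single 1 (e 1) := by
  ext i
  fin_cases i <;> simp

/-- The four monomials of degree `3` in two variables. [folklore] -/
private theorem eq_of_degree_eq_three {e : Fin 2 →₀ ℕ} (he : e.degree = 3) :
    e = Finsupp.single 0 3 ∨ e = Finsupp.single 0 2 + Finsupp.single 1 1 ∨
      e = Finsupp.single 0 1 + Finsupp.single 1 2 ∨ e = Finsupp.single 1 3 := by
  have h := he
  simp only [Finsupp.degree_eq_sum, Fin.sum_univ_two] at h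
  have he0 : e 0 ≤ 3 := by omega
  rw [finsupp_fin_two_eq e]
  interval_cases h0 : e 0
  · have h1 : e 1 = 3 := by omega
    rw [h1, Finsupp.single_zero, zero_add]
    exact Or.inr (Or.inr (Or.inr rfl))
  · have h1 : e 1 = 2 := by omega
    rw [h1]
    exact Or.inr (Or.inr (Or.inl rfl))
  · have h1 : e 1 = 1 := by omega
    rw [h1]
    exact Or.inr (Or.inl rfl)
  · have h1 : e 1 = 0 := by omega
    rw [h1, Finsupp.single_zero, add_zero]
    exact Or.inl rfl

/-- Evaluation of a binary cubic at a point: `f(u) = a u₀³ + b u₀² u₁ + c u₀ u₁² + d u₁³` with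
`a, b, c, d` the four coefficients. [folklore] -/
private theorem eval_eq_of_isHomogeneous_three {f : MvPolynomial (Fin 2) ℂ} (hf : f.IsHomogeneous 3)
    (u : Fin 2 → ℂ) :
    eval u f = coeff (Finsupp.single 0 3) f * u 0 ^ 3 +
      coeff (Finsupp.single 0 2 + Finsupp.single 1 1) f * (u 0 ^ 2 * u 1) +
      coeff (Finsupp.single 0 1 + Finsupp.single 1 2) f * (u 0 * u 1 ^ 2) +
      coeff (Finsupp.single 1 3) f * u 1 ^ 3 := by
  classical
  -- the four monomials are pairwise distinct
  have h01 : (Finsupp.single 0 3 : Fin 2 →₀ ℕ) ≠ Finsupp.single 0 2 + Finsupp.single 1 1 :=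
    fun h => by have := congrArg (fun e : Fin 2 →₀ ℕ => e 0) h; simp at this
  have h02 : (Finsupp.single 0 3 : Fin 2 →₀ ℕ) ≠ Finsupp.single 0 1 + Finsupp.single 1 2 :=
    fun h => by have := congrArg (fun e : Fin 2 →₀ ℕ => e 0) h; simp at this
  have h03 : (Finsupp.single 0 3 : Fin 2 →₀ ℕ) ≠ Finsupp.single 1 3 :=
    fun h => by have := congrArg (fun e : Fin 2 →₀ ℕ => e 0) h; simp at this
  have h12 : (Finsupp.single 0 2 + Finsupp.single 1 1 : Fin 2 →₀ ℕ) ≠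
      Finsupp.single 0 1 + Finsupp.single 1 2 :=
    fun h => by have := congrArg (fun e : Fin 2 →₀ ℕ => e 0) h; simp at this
  have h13 : (Finsupp.single 0 2 + Finsupp.single 1 1 : Fin 2 →₀ ℕ) ≠ Finsupp.single 1 3 :=
    fun h => by have := congrArg (fun e : Fin 2 →₀ ℕ => e 0) h; simp at this
  have h23 : (Finsupp.single 0 1 + Finsupp.single 1 2 : Fin 2 →₀ ℕ) ≠ Finsupp.single 1 3 :=
    fun h => by have := congrArg (fun e : Fin 2 →₀ ℕ => e 0) h; simp at this
  set S : Finset (Fin 2 →₀ ℕ) := {Finsupp.single 0 3, Finsupp.single 0 2 + Finsupp.single 1 1,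
    Finsupp.single 0 1 + Finsupp.single 1 2, Finsupp.single 1 3} with hS
  have hsub : f.support ⊆ S := by
    intro e he
    have hdeg : e.degree = 3 := by
      rw [Finsupp.degree_eq_weight_one]
      exact hf (mem_support_iff.mp he)
    rcases eq_of_degree_eq_three hdeg with h | h | h | h <;> simp [hS, h]
  rw [eval_eq', Finset.sum_subset hsub (fun e _ he => by
    rw [notMem_support_iff.mp he, zero_mul])]
  rw [hS, Finset.sum_insert (by simp [h01, h02, h03]), Finset.sum_insert (by simp [h12, h13]),
    Finset.sum_insert (by simp [h23]), Finset.sum_singleton]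
  simp only [Fin.prod_univ_two, Finsupp.coe_add, Pi.add_apply, Finsupp.single_eq_same,
    Finsupp.single_eq_of_ne (show (0 : Fin 2) ≠ 1 by decide),
    Finsupp.single_eq_of_ne (show (1 : Fin 2) ≠ 0 by decide)]
  ring

/-! ### The discriminant -/

/-- The discriminant of the binary cubic `a x³ + b x²y + c xy² + d y³` (of `a t³ + b t² + c t + d`).
[folklore] -/
private def cubicDisc (a b c d : ℂ) : ℂ :=
  b ^ 2 * c ^ 2 - 4 * a * c ^ 3 - 4 * b ^ 3 * d - 27 * a ^ 2 * d ^ 2 + 18 * a * b * c * d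

/-- **Vieta and the discriminant**: if `a t³ + b t² + c t + d = a (t − r₁)(t − r₂)(t − r₃)` then
`disc = a⁴ (r₁ − r₂)² (r₁ − r₃)² (r₂ − r₃)²`. [folklore] -/
private theorem cubicDisc_eq_of_eq_prod {a b c d r₁ r₂ r₃ : ℂ}
    (hb : b = -(a * (r₁ + r₂ + r₃))) (hc : c = a * (r₁ * r₂ + r₁ * r₃ + r₂ * r₃))
    (hd : d = -(a * (r₁ * r₂ * r₃))) :
    cubicDisc a b c d = a ^ 4 * ((r₁ - r₂) * (r₁ - r₃) * (r₂ - r₃)) ^ 2 := by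
  rw [cubicDisc, hb, hc, hd]
  ring

/-! ### Splitting a binary cubic -/

/-- **A binary cubic with `a ≠ 0` splits**: `f = a (x − r₁ y)(x − r₂ y)(x − r₃ y)`, with Vieta's
relations for the coefficients (Mathlib's `IsAlgClosed.splits` for the dehomogenised cubic).
[folklore] -/
private theorem exists_eq_prod_linear {f : MvPolynomial (Fin 2) ℂ} (hf : f.IsHomogeneous 3)
    (ha : coeff (Finsupp.single 0 3) f ≠ 0) :
    ∃ r₁ r₂ r₃ : ℂ,
      coeff (Finsupp.single 0 2 + Finsupp.single 1 1) f =
          -(coeff (Finsupp.single 0 3) f * (r₁ + r₂ + r₃)) ∧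
      coeff (Finsupp.single 0 1 + Finsupp.single 1 2) f =
          coeff (Finsupp.single 0 3) f * (r₁ * r₂ + r₁ * r₃ + r₂ * r₃) ∧
      coeff (Finsupp.single 1 3) f = -(coeff (Finsupp.single 0 3) f * (r₁ * r₂ * r₃)) ∧
      f = C (coeff (Finsupp.single 0 3) f) *
        ((X 0 - C r₁ * X 1) * (X 0 - C r₂ * X 1) * (X 0 - C r₃ * X 1)) := by
  set a := coeff (Finsupp.single 0 3) f with ha'
  set b := coeff (Finsupp.single 0 2 + Finsupp.single 1 1) f with hb'
  set c := coeff (Finsupp.single 0 1 + Finsupp.single 1 2) f with hc'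
  set d := coeff (Finsupp.single 1 3) f with hd'
  -- the dehomogenised cubic and its roots
  set p : Polynomial ℂ := Polynomial.C a * Polynomial.X ^ 3 + Polynomial.C b * Polynomial.X ^ 2 +
    Polynomial.C c * Polynomial.X + Polynomial.C d with hp
  have hdeg : p.natDegree = 3 := Polynomial.natDegree_cubic ha
  have hlead : p.leadingCoeff = a := Polynomial.leadingCoeff_cubic ha
  have hsplit : p.Splits := IsAlgClosed.splits p
  have hcard : p.roots.card = 3 := by rw [Polynomial.splits_iff_card_roots.mp hsplit, hdeg]
  obtain ⟨r₁, r₂, r₃, hroots⟩ := Multiset.card_eq_three.mp hcard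
  have hprod := hsplit.eq_prod_roots
  rw [hlead, hroots] at hprod
  simp only [Multiset.insert_eq_cons, Multiset.map_cons, Multiset.map_singleton, Multiset.prod_cons,
    Multiset.prod_singleton] at hprod
  -- Vieta by comparing coefficients
  have hexp : Polynomial.C a * ((Polynomial.X - Polynomial.C r₁) * ((Polynomial.X - Polynomial.C r₂) *
      (Polynomial.X - Polynomial.C r₃))) =
      Polynomial.C a * Polynomial.X ^ 3 + Polynomial.C (-(a * (r₁ + r₂ + r₃))) * Polynomial.X ^ 2 +
        Polynomial.C (a * (r₁ * r₂ + r₁ * r₃ + r₂ * r₃)) * Polynomial.X +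
        Polynomial.C (-(a * (r₁ * r₂ * r₃))) := by
    simp only [map_neg, map_mul, map_add]
    ring
  rw [hexp, hp] at hprod
  have hcoeff : ∀ (n : ℕ) (a' b' c' d' : ℂ),
      (Polynomial.C a' * Polynomial.X ^ 3 + Polynomial.C b' * Polynomial.X ^ 2 +
        Polynomial.C c' * Polynomial.X + Polynomial.C d').coeff n =
      (if n = 3 then a' else 0) + (if n = 2 then b' else 0) + (if n = 1 then c' else 0) +
        (if n = 0 then d' else 0) := by
    intro n a' b' c' d'
    simp only [Polynomial.coeff_add, Polynomial.coeff_C_mul_X_pow, Polynomial.coeff_C_mul_X,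
      Polynomial.coeff_C]
  have hb : b = -(a * (r₁ + r₂ + r₃)) := by
    have h := congrArg (fun q : Polynomial ℂ => q.coeff 2) hprod
    simp only [hcoeff] at h
    norm_num at h
    exact h
  have hc : c = a * (r₁ * r₂ + r₁ * r₃ + r₂ * r₃) := by
    have h := congrArg (fun q : Polynomial ℂ => q.coeff 1) hprod
    simp only [hcoeff] at h
    norm_num at h
    exact h
  have hd : d = -(a * (r₁ * r₂ * r₃)) := by
    have h := congrArg (fun q : Polynomial ℂ => q.coeff 0) hprod
    simp only [hcoeff] at h
    norm_num at h
    exact h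
  refine ⟨r₁, r₂, r₃, hb, hc, hd, ?_⟩
  -- the identity of binary forms, by evaluation
  apply MvPolynomial.funext
  intro u
  rw [eval_eq_of_isHomogeneous_three hf u, ← ha', ← hb', ← hc', ← hd', hb, hc, hd]
  simp only [map_mul, map_sub, eval_C, eval_X]
  ring

/-! ### The normal form `x y (x + y)` -/

/-- Evaluating a linear substitution: `(M · f)(x) = f(Mᵀ x)` (private copy, as in the sibling
proof files). [folklore] -/
private theorem eval_linSubst' (M : Matrix (Fin 2) (Fin 2) ℂ) (x : Fin 2 → ℂ)
    (f : MvPolynomial (Fin 2) ℂ) : eval x (linSubst (Fin 2) ℂ M f) = eval (Mᵀ *ᵥ x) f := by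
  induction f using MvPolynomial.induction_on with
  | C a => rw [linSubst_C, eval_C, eval_C]
  | add p q hp hq => rw [map_add, map_add, map_add, hp, hq]
  | mul_X p i hp =>
    rw [map_mul, map_mul, map_mul, hp, linSubst_X, eval_X]
    congr 1
    simp [mulVec, dotProduct, smul_eval]

/-- **The normal form of three distinct lines**: if `f = a ∏ (x − r_i y)` with `a ≠ 0` and pairwise
distinct `r_i`, then `M · f = c · x y (x + y)` for the explicit invertible matrix
`M = diag(r₁ − r₃, r₂ − r₃) · [[r₂, 1], [r₁, 1]]` and `c = −a (r₁−r₂)²(r₁−r₃)²(r₂−r₃)² ≠ 0`.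
[cite: BurgisserIkenmeyer2017, Prop. 2.10 (case (D, m) = (3, 2))] -/
theorem exists_linSubst_eq_smul_xyxy {f : MvPolynomial (Fin 2) ℂ} {a r₁ r₂ r₃ : ℂ} (ha : a ≠ 0)
    (h12 : r₁ ≠ r₂) (h13 : r₁ ≠ r₃) (h23 : r₂ ≠ r₃)
    (hf : f = C a * ((X 0 - C r₁ * X 1) * (X 0 - C r₂ * X 1) * (X 0 - C r₃ * X 1))) :
    ∃ M : Matrix (Fin 2) (Fin 2) ℂ, M.det ≠ 0 ∧ ∃ c : ℂ, c ≠ 0 ∧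
      linSubst (Fin 2) ℂ M f = c • (X 0 * X 1 * (X 0 + X 1)) := by
  refine ⟨!![(r₁ - r₃) * r₂, r₁ - r₃; (r₂ - r₃) * r₁, r₂ - r₃], ?_,
    -(a * ((r₁ - r₂) * (r₁ - r₃) * (r₂ - r₃)) ^ 2), ?_, ?_⟩
  · rw [Matrix.det_fin_two_of]
    have : (r₁ - r₃) * r₂ * (r₂ - r₃) - (r₁ - r₃) * ((r₂ - r₃) * r₁) =
        -((r₁ - r₂) * (r₁ - r₃) * (r₂ - r₃)) := by ring
    rw [this, neg_ne_zero]
    exact mul_ne_zero (mul_ne_zero (sub_ne_zero.mpr h12) (sub_ne_zero.mpr h13)) (sub_ne_zero.mpr h23)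
  · rw [neg_ne_zero]
    refine mul_ne_zero ha (pow_ne_zero 2 ?_)
    exact mul_ne_zero (mul_ne_zero (sub_ne_zero.mpr h12) (sub_ne_zero.mpr h13)) (sub_ne_zero.mpr h23)
  · apply MvPolynomial.funext
    intro u
    rw [eval_linSubst', hf]
    simp only [map_mul, map_sub, map_add, eval_C, eval_X, smul_eval, mulVec, dotProduct,
      Fin.sum_univ_two, transpose_apply, of_apply, cons_val', cons_val_zero, cons_val_one,
      cons_val_fin_one, empty_val']
    ring

/-- A primitive cube root of unity `ω` (a root of `t² + t + 1`) exists in `ℂ`, and `−1, −ω, −ω²`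
are pairwise distinct. [folklore] -/
private theorem exists_omega : ∃ ω : ℂ, ω ^ 2 + ω + 1 = 0 ∧ (-1 : ℂ) ≠ -ω ∧ (-1 : ℂ) ≠ -ω ^ 2 ∧
    -ω ≠ -ω ^ 2 := by
  obtain ⟨ω, hω⟩ := IsAlgClosed.exists_root
    (Polynomial.X ^ 2 + Polynomial.X + Polynomial.C (1 : ℂ)) (by
      rw [show (Polynomial.X ^ 2 + Polynomial.X + Polynomial.C (1 : ℂ)) =
          Polynomial.C 1 * Polynomial.X ^ 2 + Polynomial.C 1 * Polynomial.X + Polynomial.C 1 by simp,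
        Polynomial.degree_quadratic one_ne_zero]
      decide)
  have hω' : ω ^ 2 + ω + 1 = 0 := by
    simpa [Polynomial.IsRoot] using hω
  refine ⟨ω, hω', ?_, ?_, ?_⟩
  · intro h
    have h1 : ω = 1 := by linear_combination h
    rw [h1] at hω'
    norm_num at hω'
  · intro h
    have h1 : ω ^ 2 = 1 := by linear_combination h
    have h2 : ω = -2 := by linear_combination hω' - h1
    rw [h2] at h1
    norm_num at h1
  · intro h
    have h1 : ω ^ 2 = ω := by linear_combination h
    have h2 : ω = -1 / 2 := by linear_combination (hω' - h1) / 2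
    rw [h2] at hω'
    norm_num at hω'

/-- **The Fermat cubic has the same normal form**: `x³ + y³ = (x + y)(x + ωy)(x + ω²y)`, so
`M₀ · (x³ + y³) = c₀ · x y (x + y)` for some invertible `M₀` and `c₀ ≠ 0`.
[cite: BurgisserIkenmeyer2017, Prop. 2.10 (case (D, m) = (3, 2))] -/
theorem exists_linSubst_sum_X_pow_three_eq_smul_xyxy :
    ∃ M : Matrix (Fin 2) (Fin 2) ℂ, M.det ≠ 0 ∧ ∃ c : ℂ, c ≠ 0 ∧
      linSubst (Fin 2) ℂ M (∑ i : Fin 2, X i ^ 3) = c • (X 0 * X 1 * (X 0 + X 1)) := by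
  obtain ⟨ω, hω, h1, h2, h3⟩ := exists_omega
  refine exists_linSubst_eq_smul_xyxy (a := 1) (r₁ := -1) (r₂ := -ω) (r₃ := -ω ^ 2) one_ne_zero
    h1 h2 h3 ?_
  have hω3 : ω ^ 3 = 1 := by linear_combination (ω - 1) * hω
  apply MvPolynomial.funext
  intro u
  simp only [Fin.sum_univ_two, map_add, map_pow, map_mul, map_sub, map_neg, map_one, eval_X, eval_C]
  linear_combination (-(u 0 ^ 2 * u 1 + ω * (u 0 * u 1 ^ 2) + (ω - 1) * u 1 ^ 3)) * hω

/-! ### Nondegenerate binary cubics are polystable -/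

/-- **A binary cubic `a x³ + b x²y + c xy² + d y³` with `a ≠ 0` and non-zero discriminant is
polystable**: it lies in the `GL₂`-orbit of the Fermat cubic `x³ + y³` (both have the normal form
`x y (x + y)` up to `GL₂` and scalars), which is polystable (`isPolystable_sum_X_pow`), and
polystability is a property of `GL`-orbits (`IsPolystable.linSubst_of_det_ne_zero`).
[cite: BurgisserIkenmeyer2017, Prop. 2.10 (case (D, m) = (3, 2))] -/
theorem isPolystable_binaryCubic {f : MvPolynomial (Fin 2) ℂ} (hf : f.IsHomogeneous 3)
    (ha : coeff (Finsupp.single 0 3) f ≠ 0)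
    (hdisc : cubicDisc (coeff (Finsupp.single 0 3) f) (coeff (Finsupp.single 0 2 + Finsupp.single 1 1) f)
      (coeff (Finsupp.single 0 1 + Finsupp.single 1 2) f) (coeff (Finsupp.single 1 3) f) ≠ 0) :
    IsPolystable f := by
  obtain ⟨r₁, r₂, r₃, hb, hc, hd, hfeq⟩ := exists_eq_prod_linear hf ha
  rw [cubicDisc_eq_of_eq_prod hb hc hd] at hdisc
  have hprod : (r₁ - r₂) * (r₁ - r₃) * (r₂ - r₃) ≠ 0 := by
    intro h
    apply hdisc
    rw [h, zero_pow two_ne_zero, mul_zero]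
  have h12 : r₁ ≠ r₂ := fun h => hprod (by rw [h, sub_self, zero_mul, zero_mul])
  have h13 : r₁ ≠ r₃ := fun h => hprod (by rw [h, sub_self, mul_zero, zero_mul])
  have h23 : r₂ ≠ r₃ := fun h => hprod (by rw [h, sub_self, mul_zero])
  obtain ⟨M, hM, c, hc0, hMf⟩ := exists_linSubst_eq_smul_xyxy ha h12 h13 h23 hfeq
  obtain ⟨M₀, hM₀, c₀, hc₀, hM₀f⟩ := exists_linSubst_sum_X_pow_three_eq_smul_xyxy
  -- a cube root absorbs the ratio of the two scalars
  obtain ⟨μ, hμ⟩ := IsAlgClosed.exists_pow_nat_eq (c / c₀) (by norm_num : 0 < 3)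
  have hμ0 : μ ≠ 0 := by
    rintro rfl
    rw [zero_pow three_ne_zero] at hμ
    exact div_ne_zero hc0 hc₀ hμ.symm
  have hsum : (∑ i : Fin 2, X i ^ 3 : MvPolynomial (Fin 2) ℂ).IsHomogeneous 3 :=
    IsHomogeneous.sum _ _ _ fun i _ => isHomogeneous_X_pow i 3
  have key : linSubst (Fin 2) ℂ (μ • M₀) (∑ i : Fin 2, X i ^ 3) = linSubst (Fin 2) ℂ M f := by
    rw [linSubst_smul_of_isHomogeneous hsum, hM₀f, hMf, smul_smul, hμ, div_mul_cancel₀ c hc₀]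
  have hMinv : M⁻¹ * M = 1 := Matrix.nonsing_inv_mul M (isUnit_iff_ne_zero.mpr hM)
  have hf' : f = linSubst (Fin 2) ℂ (M⁻¹ * (μ • M₀)) (∑ i : Fin 2, X i ^ 3) := by
    rw [linSubst_mul, AlgHom.comp_apply, key, ← AlgHom.comp_apply, ← linSubst_mul, hMinv,
      linSubst_one, AlgHom.id_apply]
  rw [hf']
  refine (isPolystable_sum_X_pow 2 (by norm_num : 1 < 3)).linSubst_of_det_ne_zero ?_
  rw [det_mul, det_smul, Fintype.card_fin]
  refine mul_ne_zero ?_ (mul_ne_zero (pow_ne_zero 2 hμ0) hM₀)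
  rw [Matrix.det_nonsing_inv, Ring.inverse_eq_inv']
  exact inv_ne_zero hM

end BinaryCubic

open BinaryCubic in
/-- **BI 2017, Prop. 2.10 at `(D, m) = (3, 2)`: almost all binary cubics are polystable.**
`IsZariskiGeneric 3 IsPolystable` on `Sym³ ℂ²`, with the test polynomial `A · Disc(A, B, C, D)` in the
four coefficients (`A, D` the coefficients of `x³, y³`; value `−27` at `x³ + y³`): off its zero set a
binary cubic splits into three distinct linear factors and is `GL₂`-equivalent to `x³ + y³`
(`isPolystable_binaryCubic`). The general `D ≥ 3`, `m ≥ 2` body of Prop. 2.10 (Thm. 2.3 + Luna 1973)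
is NOT proved here. [cite: BurgisserIkenmeyer2017, Prop. 2.10 (case (D, m) = (3, 2), TeX L633–640)] -/
theorem BI2017_prop_2_10_three_two :
    IsZariskiGeneric 3 (IsPolystable : MvPolynomial (Fin 2) ℂ → Prop) := by
  have hA : (Finsupp.single 0 3 : Fin 2 →₀ ℕ) ∈ degMonomials (Fin 2) 3 := by
    rw [mem_degMonomials_iff, Finsupp.degree_single]
  have hB : (Finsupp.single 0 2 + Finsupp.single 1 1 : Fin 2 →₀ ℕ) ∈ degMonomials (Fin 2) 3 := by
    rw [mem_degMonomials_iff, map_add, Finsupp.degree_single, Finsupp.degree_single]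
  have hC : (Finsupp.single 0 1 + Finsupp.single 1 2 : Fin 2 →₀ ℕ) ∈ degMonomials (Fin 2) 3 := by
    rw [mem_degMonomials_iff, map_add, Finsupp.degree_single, Finsupp.degree_single]
  have hD : (Finsupp.single 1 3 : Fin 2 →₀ ℕ) ∈ degMonomials (Fin 2) 3 := by
    rw [mem_degMonomials_iff, Finsupp.degree_single]
  set A : MvPolynomial (DegIdx (Fin 2) 3) ℂ := X ⟨_, hA⟩ with hAdef
  set B : MvPolynomial (DegIdx (Fin 2) 3) ℂ := X ⟨_, hB⟩ with hBdef
  set Cc : MvPolynomial (DegIdx (Fin 2) 3) ℂ := X ⟨_, hC⟩ with hCdef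
  set Dd : MvPolynomial (DegIdx (Fin 2) 3) ℂ := X ⟨_, hD⟩ with hDdef
  -- the values of the four coordinates at a form `f`
  have hval : ∀ f : MvPolynomial (Fin 2) ℂ,
      aeval (formCoeff 3 f) A = coeff (Finsupp.single 0 3) f ∧
      aeval (formCoeff 3 f) B = coeff (Finsupp.single 0 2 + Finsupp.single 1 1) f ∧
      aeval (formCoeff 3 f) Cc = coeff (Finsupp.single 0 1 + Finsupp.single 1 2) f ∧
      aeval (formCoeff 3 f) Dd = coeff (Finsupp.single 1 3) f := fun f => by
    refine ⟨?_, ?_, ?_, ?_⟩ <;> simp only [hAdef, hBdef, hCdef, hDdef, aeval_X, formCoeff_apply]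
  refine ⟨A * (B ^ 2 * Cc ^ 2 - 4 * A * Cc ^ 3 - 4 * B ^ 3 * Dd - 27 * A ^ 2 * Dd ^ 2 +
    18 * A * B * Cc * Dd), ?_, fun f hf hF => ?_⟩
  · -- nonzero: value `-27` at the Fermat cubic
    intro h
    set f₀ : MvPolynomial (Fin 2) ℂ := X 0 ^ 3 + X 1 ^ 3 with hf₀
    have h03 : (Finsupp.single 1 3 : Fin 2 →₀ ℕ) ≠ Finsupp.single 0 3 :=
      fun h => by have := congrArg (fun e : Fin 2 →₀ ℕ => e 0) h; simp at this
    have h0B : (Finsupp.single 0 3 : Fin 2 →₀ ℕ) ≠ Finsupp.single 0 2 + Finsupp.single 1 1 :=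
      fun h => by have := congrArg (fun e : Fin 2 →₀ ℕ => e 0) h; simp at this
    have h1B : (Finsupp.single 1 3 : Fin 2 →₀ ℕ) ≠ Finsupp.single 0 2 + Finsupp.single 1 1 :=
      fun h => by have := congrArg (fun e : Fin 2 →₀ ℕ => e 0) h; simp at this
    have h0C : (Finsupp.single 0 3 : Fin 2 →₀ ℕ) ≠ Finsupp.single 0 1 + Finsupp.single 1 2 :=
      fun h => by have := congrArg (fun e : Fin 2 →₀ ℕ => e 0) h; simp at this
    have h1C : (Finsupp.single 1 3 : Fin 2 →₀ ℕ) ≠ Finsupp.single 0 1 + Finsupp.single 1 2 :=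
      fun h => by have := congrArg (fun e : Fin 2 →₀ ℕ => e 0) h; simp at this
    have h30 : (Finsupp.single 0 3 : Fin 2 →₀ ℕ) ≠ Finsupp.single 1 3 := fun h => h03 h.symm
    have ca : coeff (Finsupp.single 0 3) f₀ = 1 := by
      rw [hf₀, coeff_add, coeff_X_pow, coeff_X_pow, if_pos rfl, if_neg h03, add_zero]
    have cb : coeff (Finsupp.single 0 2 + Finsupp.single 1 1) f₀ = 0 := by
      rw [hf₀, coeff_add, coeff_X_pow, coeff_X_pow, if_neg h0B, if_neg h1B, add_zero]
    have cc : coeff (Finsupp.single 0 1 + Finsupp.single 1 2) f₀ = 0 := by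
      rw [hf₀, coeff_add, coeff_X_pow, coeff_X_pow, if_neg h0C, if_neg h1C, add_zero]
    have cd : coeff (Finsupp.single 1 3) f₀ = 1 := by
      rw [hf₀, coeff_add, coeff_X_pow, coeff_X_pow, if_neg h30, if_pos rfl, zero_add]
    obtain ⟨vA, vB, vC, vD⟩ := hval f₀
    have := congrArg (aeval (formCoeff 3 f₀)) h
    simp only [map_mul, map_sub, map_add, map_pow, vA, vB, vC, vD, ca, cb, cc, cd, map_ofNat,
      map_zero] at this
    norm_num at this
  · obtain ⟨vA, vB, vC, vD⟩ := hval f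
    simp only [map_mul, map_sub, map_add, map_pow, vA, vB, vC, vD, map_ofNat] at hF
    have ha : coeff (Finsupp.single 0 3) f ≠ 0 := by
      intro h0
      apply hF
      rw [h0, zero_mul]
    refine isPolystable_binaryCubic hf ha fun h0 => hF ?_
    rw [cubicDisc] at h0
    rw [h0, mul_zero]

/-- **Exact residual of Prop. 2.10 after the two slice files**: the named fact follows from its
instances with `D ≥ 3`, `m ≥ 2` and `(D, m) ≠ (3, 2)` (none of which is proved in the tree; printed
proof: Thm. 2.3 + Luna 1973). [cite: BurgisserIkenmeyer2017, Prop. 2.10] -/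
theorem BI2017_prop_2_10_of_main'
    (h : ∀ (D m : ℕ), 3 ≤ D → 2 ≤ m → (D, m) ≠ (3, 2) →
      IsZariskiGeneric D (IsPolystable : MvPolynomial (Fin m) ℂ → Prop)) :
    BI2017_prop_2_10 := by
  refine BI2017_prop_2_10_of_main fun D m hD hm => ?_
  by_cases h32 : (D, m) = (3, 2)
  · obtain ⟨rfl, rfl⟩ : D = 3 ∧ m = 2 := by simpa using h32
    exact BI2017_prop_2_10_three_two
  · exact h D m hD hm h32

end Literature.Computability.AlgebraicComplexity

end
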